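import Literature.Analysis.Calculus.SmoothCutoff
import Mathlib.Analysis.SpecialFunctions.Log.Deriv
import Mathlib.Analysis.Calculus.Deriv.Comp
import Mathlib.Analysis.Calculus.Deriv.Mul
import Mathlib.Analysis.Calculus.Deriv.Inv
import Mathlib.Analysis.Calculus.ContDiff.Deriv
import Mathlib.Analysis.Calculus.IteratedDeriv.Lemmas
import Mathlib.Topology.Order.Compact
import HarnessLib

/-!
# Logarithmic cutoffs with small `t τ'` and `t² τ''`

Topic `Literature/Analysis/Calculus` (general real analysis). A brick of the proof programme of
`Literature.Geometry.Riemannian.BaerHankePscGluing` (Bär–Hanke 2023, §3): to interpolate, inside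
a collar `t ∈ [0, t₁]` of the boundary, between a metric family `g_t` and its `C`-normal
modification `g_0 + t ġ_0 − C t² g_0` (which differ by `O(t²)`) through metrics of positive scalar
curvature, one needs a cutoff `τ` with `τ = 1` near `t = 0`, `τ = 0` for `t ≥ t₁`, and BOTH
`|t τ'(t)|` and `|t² τ''(t)|` uniformly small — the second derivatives of `τ(t) · O(t²)` are then
`O(τ) + O(small)`. Such cutoffs are smooth transitions in the variable `log t` over a long
logarithmic interval (the classical "logarithmic cutoff"; compare `LogBlend.lean` and
`TubeLogPacing.lean` of `Literature/Topology/FourManifolds`, which control the first derivative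
only).

* `exists_abs_le_of_eq_zero_off_Icc` — a continuous function vanishing off `[0, 1]` is bounded;
* `deriv_deriv_smoothTransition_eq_zero_off_Icc`, `contDiff_deriv_smoothTransition`,
  `exists_abs_deriv_and_deriv_deriv_smoothTransition_le` — a common bound for the first two
  derivatives of Mathlib's `Real.smoothTransition` on `ℝ` (the first-derivative facts are the
  tree's `deriv_smoothTransition_of_nonpos` / `_of_one_le` / `exists_bound_deriv_smoothTransition`
  of `SmoothCutoff.lean`);
* `exists_logCutoff` — **the logarithmic cutoff**: for `η > 0` and `t₁ > 0` there are
  `t₀ ∈ (0, t₁)` and a `C^∞` function `τ : ℝ → ℝ` with `τ = 1` on `(-∞, t₀]`, `τ = 0` on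
  `[t₁, ∞)`, `0 ≤ τ ≤ 1`, `|t τ'(t)| ≤ η` and `|t² τ''(t)| ≤ η` for all `t > 0`
  (`τ(t) = S((log t₁ − log (max t t₀)) / L)` with `S = Real.smoothTransition`, `t₀ = t₁ e^{-L}`,
  `L` large: `t τ' = -S'/L`, `t² τ'' = S''/L² + S'/L`).

Everything is proved; no definitions, no named facts (D-0026): the cutoff is an explicit
expression inside the proof and is exported existentially.

## References

* C. Bär, B. Hanke, *Boundary conditions for scalar curvature*, arXiv:2012.09127, §3 (Lemma 25
  and the proof of Prop. 23: cutoff deformations supported near the boundary). [BarHanke2023]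
* L. Hörmander, *The Analysis of Linear Partial Differential Operators I*, §1.4 (cutoff
  functions). [folklore]
-/

noncomputable section

open Set Filter Real
open scoped Topology ContDiff

namespace Literature.Analysis.Calculus

/-! ### Bounded derivatives of the smooth transition -/

/-- A continuous real function vanishing off `[0, 1]` is bounded. [folklore] -/
theorem exists_abs_le_of_eq_zero_off_Icc {f : ℝ → ℝ} (hf : Continuous f)
    (h0 : ∀ x, x ∉ Icc (0 : ℝ) 1 → f x = 0) : ∃ C : ℝ, 0 ≤ C ∧ ∀ x, |f x| ≤ C := by
  obtain ⟨C, hC⟩ := isCompact_Icc.exists_bound_of_continuousOn (s := Icc (0 : ℝ) 1)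
    hf.continuousOn
  have hC0 : 0 ≤ C := (norm_nonneg _).trans (hC 0 ⟨le_rfl, zero_le_one⟩)
  refine ⟨C, hC0, fun x ↦ ?_⟩
  by_cases hx : x ∈ Icc (0 : ℝ) 1
  · exact (Real.norm_eq_abs _).symm.le.trans (hC x hx)
  · rw [h0 x hx, abs_zero]
    exact hC0

/-- `S''` vanishes off `[0, 1]` (`S'` is locally zero there). [folklore] -/
theorem deriv_deriv_smoothTransition_eq_zero_off_Icc (x : ℝ) (hx : x ∉ Icc (0 : ℝ) 1) :
    deriv (deriv smoothTransition) x = 0 := by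
  rw [mem_Icc, not_and_or, not_le, not_le] at hx
  rcases hx with hx | hx
  · have hev : deriv smoothTransition =ᶠ[𝓝 x] fun _ ↦ (0 : ℝ) := by
      filter_upwards [Iio_mem_nhds hx] with y hy
      exact deriv_smoothTransition_of_nonpos hy.le
    rw [hev.deriv_eq]
    exact deriv_const x 0
  · have hev : deriv smoothTransition =ᶠ[𝓝 x] fun _ ↦ (0 : ℝ) := by
      filter_upwards [Ioi_mem_nhds hx] with y hy
      exact deriv_smoothTransition_of_one_le hy.le
    rw [hev.deriv_eq]
    exact deriv_const x 0

/-- `S'` is `C^∞`. [folklore] -/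
theorem contDiff_deriv_smoothTransition : ContDiff ℝ ∞ (deriv smoothTransition) :=
  smoothTransition.contDiff.iterate_deriv 1

/-- **A common bound for `|S'|` and `|S''|`** on `ℝ`. [folklore] -/
theorem exists_abs_deriv_and_deriv_deriv_smoothTransition_le :
    ∃ C : ℝ, 0 ≤ C ∧ (∀ x, |deriv smoothTransition x| ≤ C) ∧
      ∀ x, |deriv (deriv smoothTransition) x| ≤ C := by
  obtain ⟨C₁, hC₁0, hC₁⟩ := exists_bound_deriv_smoothTransition
  obtain ⟨C₂, -, hC₂⟩ := exists_abs_le_of_eq_zero_off_Icc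
    (contDiff_deriv_smoothTransition.continuous_deriv (by simp))
    deriv_deriv_smoothTransition_eq_zero_off_Icc
  exact ⟨max C₁ C₂, le_max_of_le_left hC₁0, fun x ↦ (hC₁ x).trans (le_max_left _ _),
    fun x ↦ (hC₂ x).trans (le_max_right _ _)⟩

/-! ### The logarithmic cutoff -/

/-- **Logarithmic cutoff.** For `η > 0` and `t₁ > 0` there are `t₀ ∈ (0, t₁)` and a `C^∞`
function `τ : ℝ → ℝ` with `τ = 1` on `(-∞, t₀]`, `τ = 0` on `[t₁, ∞)`, `0 ≤ τ ≤ 1`, and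
`|t τ'(t)| ≤ η`, `|t² τ''(t)| ≤ η` for every `t > 0`. Construction:
`τ(t) = S((log t₁ − log (max t t₀)) / L)`, `S` Mathlib's smooth transition, `t₀ = t₁ e^{-L}`;
for `t > 0` this is `S((log t₁ − log t)/L)` (both are `1` below `t₀`), so `t τ' = -S'/L` and
`t² τ'' = S''/L² + S'/L`, small for `L` large. [cite: BarHanke2023, §3, Lemma 25 and proof of Prop. 23 (cutoffs)] -/
theorem exists_logCutoff {η t₁ : ℝ} (hη : 0 < η) (ht₁ : 0 < t₁) :
    ∃ t₀ : ℝ, 0 < t₀ ∧ t₀ < t₁ ∧ ∃ τ : ℝ → ℝ, ContDiff ℝ ∞ τ ∧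
      (∀ t, t ≤ t₀ → τ t = 1) ∧ (∀ t, t₁ ≤ t → τ t = 0) ∧ (∀ t, τ t ∈ Icc (0 : ℝ) 1) ∧
      (∀ t, 0 < t → |t * deriv τ t| ≤ η) ∧
      (∀ t, 0 < t → |t ^ 2 * deriv (deriv τ) t| ≤ η) := by
  obtain ⟨C₁, hC₁0, hC₁, hC₁'⟩ := exists_abs_deriv_and_deriv_deriv_smoothTransition_le
  -- the logarithmic length `L ≥ 1`, `L ≥ 2 (C₁ + C₁ + 1) / η`
  set L : ℝ := 2 * (C₁ + C₁ + 1) / η + 1 with hL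
  have hLpos' : 0 < 2 * (C₁ + C₁ + 1) / η := by positivity
  have hL1 : 1 ≤ L := by linarith
  have hL0 : 0 < L := by linarith
  have hLη : 2 * (C₁ + C₁ + 1) / η ≤ L := by linarith
  have hC₁L : C₁ / L ≤ η / 2 := by
    rw [div_le_iff₀ hL0]
    have h1 : 2 * (C₁ + C₁ + 1) ≤ L * η := by rwa [div_le_iff₀ hη] at hLη
    nlinarith
  have hC₂L : C₁ / L ^ 2 ≤ η / 2 := by
    have hLL : L ≤ L ^ 2 := by nlinarith
    have h2 : C₁ / L ^ 2 ≤ C₁ / L := div_le_div_of_nonneg_left hC₁0 hL0 hLL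
    refine h2.trans ?_
    rw [div_le_iff₀ hL0]
    have h1 : 2 * (C₁ + C₁ + 1) ≤ L * η := by rwa [div_le_iff₀ hη] at hLη
    nlinarith
  -- the core depth `t₀ = t₁ e^{-L}`
  set t₀ : ℝ := t₁ * exp (-L) with ht₀
  have ht₀0 : 0 < t₀ := by positivity
  have ht₀1 : t₀ < t₁ := by
    calc t₀ = t₁ * exp (-L) := rfl
      _ < t₁ * 1 := by
          apply mul_lt_mul_of_pos_left _ ht₁
          exact exp_lt_one_iff.2 (by linarith)
      _ = t₁ := mul_one _
  have hlog₀ : Real.log t₀ = Real.log t₁ - L := by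
    rw [ht₀, Real.log_mul ht₁.ne' (exp_pos _).ne', Real.log_exp]
    ring
  -- the cutoff and its unguarded form on `(0, ∞)`
  set u : ℝ → ℝ := fun t ↦ (Real.log t₁ - Real.log t) / L with hu
  set f : ℝ → ℝ := fun t ↦ smoothTransition (u t) with hf
  set τ : ℝ → ℝ := fun t ↦ smoothTransition ((Real.log t₁ - Real.log (max t t₀)) / L) with hτ
  have hτ_le : ∀ t, t ≤ t₀ → τ t = 1 := by
    intro t ht
    simp only [hτ, max_eq_right ht, hlog₀]
    rw [show (Real.log t₁ - (Real.log t₁ - L)) / L = 1 by field_simp; ring]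
    exact smoothTransition.one_of_one_le le_rfl
  have hf_le : ∀ t, 0 < t → t ≤ t₀ → f t = 1 := by
    intro t ht htt
    simp only [hf, hu]
    refine smoothTransition.one_of_one_le ?_
    rw [le_div_iff₀ hL0, one_mul]
    have := Real.log_le_log ht htt
    linarith
  have hτf : ∀ t, 0 < t → τ t = f t := by
    intro t ht
    rcases le_or_gt t t₀ with htt | htt
    · rw [hτ_le t htt, hf_le t ht htt]
    · simp only [hτ, hf, hu, max_eq_left htt.le]
  have hτf_ev : ∀ t, 0 < t → τ =ᶠ[𝓝 t] f := fun t ht ↦ by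
    filter_upwards [Ioi_mem_nhds ht] with s hs
    exact hτf s hs
  -- derivatives of the unguarded form
  have hud : ∀ t, 0 < t → HasDerivAt u (-t⁻¹ / L) t := by
    intro t ht
    have h := ((Real.hasDerivAt_log ht.ne').const_sub (Real.log t₁)).div_const L
    simpa using h
  have hSd : ∀ x, HasDerivAt smoothTransition (deriv smoothTransition x) x := fun x ↦
    ((smoothTransition.contDiff (n := 1)).differentiable (by simp) x).hasDerivAt
  have hS'd : ∀ x, HasDerivAt (deriv smoothTransition) (deriv (deriv smoothTransition) x) x :=
    fun x ↦ (contDiff_deriv_smoothTransition.differentiable (by simp) x).hasDerivAt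
  have hfd : ∀ t, 0 < t →
      HasDerivAt f (deriv smoothTransition (u t) * (-t⁻¹ / L)) t := fun t ht ↦
    (hSd (u t)).comp t (hud t ht)
  have hτd : ∀ t, 0 < t → HasDerivAt τ (deriv smoothTransition (u t) * (-t⁻¹ / L)) t :=
    fun t ht ↦ (hfd t ht).congr_of_eventuallyEq (hτf_ev t ht)
  have hτ'ev : ∀ t, 0 < t →
      deriv τ =ᶠ[𝓝 t] fun s ↦ deriv smoothTransition (u s) * (-s⁻¹ / L) := fun t ht ↦ by
    filter_upwards [Ioi_mem_nhds ht] with s hs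
    exact (hτd s hs).deriv
  have hgd : ∀ t, 0 < t → HasDerivAt (fun s ↦ deriv smoothTransition (u s) * (-s⁻¹ / L))
      (deriv (deriv smoothTransition) (u t) * (-t⁻¹ / L) * (-t⁻¹ / L) +
        deriv smoothTransition (u t) * (-(-(t ^ 2)⁻¹) / L)) t := by
    intro t ht
    have h1 : HasDerivAt (fun s ↦ deriv smoothTransition (u s))
        (deriv (deriv smoothTransition) (u t) * (-t⁻¹ / L)) t := (hS'd (u t)).comp t (hud t ht)
    have h2 : HasDerivAt (fun s : ℝ ↦ -s⁻¹ / L) (-(-(t ^ 2)⁻¹) / L) t :=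
      ((hasDerivAt_inv ht.ne').neg).div_const L
    exact h1.mul h2
  have hτ'' : ∀ t, 0 < t → deriv (deriv τ) t =
      deriv (deriv smoothTransition) (u t) * (-t⁻¹ / L) * (-t⁻¹ / L) +
        deriv smoothTransition (u t) * (-(-(t ^ 2)⁻¹) / L) := fun t ht ↦ by
    rw [(hτ'ev t ht).deriv_eq]
    exact (hgd t ht).deriv
  -- smoothness
  have hτC : ContDiff ℝ ∞ τ := by
    rw [contDiff_iff_contDiffAt]
    intro t
    rcases lt_or_ge t t₀ with ht | ht
    · have hev : τ =ᶠ[𝓝 t] fun _ ↦ (1 : ℝ) := by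
        filter_upwards [Iio_mem_nhds ht] with s hs
        exact hτ_le s hs.le
      exact contDiffAt_const.congr_of_eventuallyEq hev
    · have ht' : 0 < t := ht₀0.trans_le ht
      have hfC : ContDiffAt ℝ ∞ f t :=
        smoothTransition.contDiff.contDiffAt.comp t
          ((contDiffAt_const.sub (Real.contDiffAt_log.2 ht'.ne')).div_const L)
      exact hfC.congr_of_eventuallyEq (hτf_ev t ht')
  refine ⟨t₀, ht₀0, ht₀1, τ, hτC, hτ_le, fun t ht ↦ ?_, fun t ↦ ?_, fun t ht ↦ ?_, fun t ht ↦ ?_⟩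
  · -- `τ = 0` on `[t₁, ∞)`
    have ht' : 0 < t := ht₁.trans_le ht
    rw [hτf t ht']
    simp only [hf, hu]
    refine smoothTransition.zero_of_nonpos ?_
    apply div_nonpos_of_nonpos_of_nonneg _ hL0.le
    have := Real.log_le_log ht₁ ht
    linarith
  · exact ⟨smoothTransition.nonneg _, smoothTransition.le_one _⟩
  · -- `|t τ'| ≤ η`
    rw [(hτd t ht).deriv]
    have heq : t * (deriv smoothTransition (u t) * (-t⁻¹ / L)) =
        -(deriv smoothTransition (u t) / L) := by
      field_simp
    rw [heq, abs_neg, abs_div, abs_of_pos hL0]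
    calc |deriv smoothTransition (u t)| / L ≤ C₁ / L :=
          div_le_div_of_nonneg_right (hC₁ _) hL0.le
      _ ≤ η / 2 := hC₁L
      _ ≤ η := by linarith
  · -- `|t² τ''| ≤ η`
    rw [hτ'' t ht]
    have heq : t ^ 2 * (deriv (deriv smoothTransition) (u t) * (-t⁻¹ / L) * (-t⁻¹ / L) +
        deriv smoothTransition (u t) * (-(-(t ^ 2)⁻¹) / L)) =
        deriv (deriv smoothTransition) (u t) / L ^ 2 + deriv smoothTransition (u t) / L := by
      field_simp
    rw [heq]
    calc |deriv (deriv smoothTransition) (u t) / L ^ 2 + deriv smoothTransition (u t) / L|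
        ≤ |deriv (deriv smoothTransition) (u t) / L ^ 2| + |deriv smoothTransition (u t) / L| :=
          abs_add_le _ _
      _ = |deriv (deriv smoothTransition) (u t)| / L ^ 2 + |deriv smoothTransition (u t)| / L := by
          rw [abs_div, abs_div, abs_of_pos hL0, abs_of_pos (by positivity : (0 : ℝ) < L ^ 2)]
      _ ≤ C₁ / L ^ 2 + C₁ / L := add_le_add
          (div_le_div_of_nonneg_right (hC₁' _) (by positivity))
          (div_le_div_of_nonneg_right (hC₁ _) hL0.le)
      _ ≤ η / 2 + η / 2 := add_le_add hC₂L hC₁L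
      _ = η := by ring

end Literature.Analysis.Calculus
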